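import Mathlib
import HarnessLib
import Summits.HubbardSuperconductivity.HubbardSuperconductivity.Theorems.KLProgrammeKLRegimeEnginePairLadderRepin
import Summits.HubbardSuperconductivity.HubbardSuperconductivity.Theorems.KLProgrammeKLRegimeEnginePairLadderFamilyStep
import Summits.HubbardSuperconductivity.HubbardSuperconductivity.Theorems.KLProgrammeKLRegimeSplitEdgeFactsTransferLines

/-!
# Route `KLProgramme` — ENGINE child gen 8 (stmt-HubbardSuperconductivity-20437 `KLRegimeEngineV17F2`), skeleton v2 class #5 «(S)-transfer», stub (c):
# the class-#5 PRODUCER DOOR — `pairTransferPinnedAt_succ` (plan g20 (R54d): one owner = seat p1; cell gate-hubbard-kl, seat hubbard-kl-p1 g12)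

WHY.  The pinned member clause of class #5 at scale `n+1` (`PairTransferPinnedAt … (n+1) φ`, `…EngineV8PairTransferExport2` p576787) is produced from THREE
resolvent relations per pair class `Qm` — the history member's straddle at scale `n` (`X ≈ C₀·M′`, weight `b′`, `C₀ = klPairArrayF n Qm`), the plain step
(E2)ₙ₊₁ (`C₁ ≈ C₀·N₀`, weight `w`, `C₁ = klPairArrayF (n+1) Qm`) and the member's Wick tower along slice `n+1` (`Y ≈ X·N`, weight `w₁`, `Y` = the bare-ball array of
`𝒱₄(e^{Δ_{S_φ}}𝒱_{n+1}[K_{n+1}])`) — by k3c1's fourth side of the resummation square RE-PINNED (`kltc_transfer_compose_fwd_on_repin`, p547653): the composite weight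
`b′ + w − w₁` is re-keyed to the PINNED target `t := klTransferWeight … (K_{n+1}) (n+1) φ Qm` at the price `(9/4)m²·δ`, `δ ≥ Σ_p |(b′ + w − w₁) − t|`.
* §1 **`pairTransferPinnedAt_succ`** — BY NAME: per pair class at resolution `n+1` the caller (the (c) closer) supplies the three relations with their error
  majorants on the bare ball, the intermediate majorant `E₁`, the smallness lines, the slack `δ`, and ONE budget inequality
  `E_a + FT_{|w₁|}(E₁) + (9/4)m²δ ≤ transferBarAt … (n+1) Qm` ⟹ `PairTransferPinnedAt L M G P r β U μ (n+1) φ`.  The tower relation `Y ≈ X·N` carries the frame shift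
  `K_n → K_{n+1}` (as in `pairLadderStepAtV17F2_of_pairTransferAtCov`, p546910: `X` is keyed at the history's frame).
* §2 the SLACK `δ` against the conservation identity (`klTransferWeight_succ`, p577392): at the target frame `K`,
  `Σ_p |(b′ + w − w₁) − t_{n+1}[φ]| ≤ Σ|b′ − t_n[φ + s_{n+1}]| + Σ|w − klSliceWeightPlain (n+1)| + Σ|w₁ − klSliceWeightSmeared (n+1) φ|`
  (`sum_abs_composite_sub_klTransferWeight_succ_le`): the three summands are the FRAME SLACK of the pinned history weight and the deviations of the tower's actual
  rung weights from the model slice weights; all three vanish at a fixed frame with the model weights (`composite_eq_klTransferWeight_succ`, `δ = 0`).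
* §3 **`pairLadderStepAtV17F2_of_pairTransferPinnedAt`** — the pinned RE-KEY of p546910 (k3c1 g10 (a), taken here per (R54d)): (E2-F2) `PairLadderStepAtV17F2 … n` from the
  PINNED history member `PairTransferPinnedAt … (n−1) φ` + its tower, the two model lines discharged by `pairTransferAtCov_of_pinned_of_frameOK` (p580182) under
  `FrameOK R U N μ (K_{n−1})`, `klBetaMin ≤ β ≤ L`, `2^18 ≤ G.bhi`.
Exact algebra over landed lemmas; nothing about the model's sizes is asserted (the three relations are the (c) closer's obligations); nothing asserts superconductivity.  0 kit.
-/

noncomputable section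

namespace Summit.HubbardSuperconductivity.HubbardSuperconductivity.Theorems.KLRegimeSplit

set_option linter.dupNamespace false -- summit = problem name (single-conjunct summit), D-0017

open Finset Matrix Literature.MathematicalPhysics.QuantumLattice Literature.Probability.LatticeModels
open Summit.HubbardSuperconductivity.HubbardSuperconductivity.Theorems.KLProgrammeLegKernels
open Summit.HubbardSuperconductivity.HubbardSuperconductivity.Theorems.TwoPointAssembly

/-! ## §1 The producer door -/

section Door

variable (L M : ℕ) [NeZero L] [NeZero M]

/-- **`pairTransferPinnedAt_succ` — the class-#5 producer door at scale `n+1`, member `φ`.**  Per pair class `Qm` at resolution `n+1`, with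
`C₀ := klPairArrayF n Qm`, `C₁ := klPairArrayF (n+1) Qm` (`|C₁| ≤ m`) and the PINNED target `t p := klTransferWeight … (K_{n+1}) (n+1) φ Qm p`, the caller supplies:
arrays `X` (history member, vanishing off the bare ball), `Y` (vanishing off the ball and EQUAL on it to `𝒱₄(e^{Δ_{S_φ}}𝒱_{n+1}[K_{n+1}])(Qm;k,k′)`, `S_φ = softCovOf (K_{n+1}) φ`);
the plain step `(1 + diag w·C₀)N₀ = 1`, `‖klPairAmplitude (K_{n+1}) (n+1) Qm − C₀N₀‖ ≤ E ≤ e`; the history straddle `(1 − diag b′·C₀)M′ = 1`, `‖X − C₀M′‖ ≤ R′`; the tower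
`(1 + diag w₁·X)N = 1`, `‖Y − XN‖ ≤ E_a`; `E₁ ≥ R′ + FT_{|w+b′|}(E)`, `E₁ ≤ e₁`; smallness `(m+e)Σ|w+b′| ≤ 1/3`, `((3/2)m+e₁)Σ|w₁| ≤ 1/3`, `mΣ|b′+w−w₁| ≤ 1/3`, `mΣ|t| ≤ 1/3`;
the slack `Σ|(b′+w−w₁) − t| ≤ δ`; and the budget `E_a + FT_{|w₁|}(E₁) + (9/4)m²δ ≤ transferBarAt … (n+1) Qm` on the ball ⟹ `PairTransferPinnedAt L M G P r β U μ (n+1) φ`. -/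
theorem pairTransferPinnedAt_succ {G : GeoConsts} {P : SplitConsts} {r β U μ : ℝ} {n : ℕ} {m : ℝ} (hm : 0 ≤ m) {φ : FreqMomentum L M → ℝ}
    (hC₁ : ∀ Qm s t, ‖klPairArrayF L M β U μ (n + 1) Qm s t‖ ≤ m)
    (hdata : ∀ Qm : TorusSite 2 L, IsPairClassAt L Qm (n + 1) →
      ∃ (X Y N₀ M' N : Matrix (TorusSite 2 L) (TorusSite 2 L) ℂ) (w b' w₁ : TorusSite 2 L → ℝ)
        (E R' Ea E₁ : TorusSite 2 L → TorusSite 2 L → ℝ) (e e₁ δ : ℝ),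
        0 ≤ e ∧ 0 ≤ e₁ ∧
        (∀ x y, ¬(x ∈ klBall L μ 0 ∧ y ∈ klBall L μ 0) → X x y = 0) ∧
        (∀ x y, ¬(x ∈ klBall L μ 0 ∧ y ∈ klBall L μ 0) → Y x y = 0) ∧
        (∀ k ∈ klBall L μ 0, ∀ k' ∈ klBall L μ 0,
          Y k k' = klCovSmearedPairAmplitude L M β U μ (klFlowFrameU L M β U μ (n + 1)) (n + 1)
            (softCovOf L M β μ (klFlowFrameU L M β U μ (n + 1)) φ) Qm k k') ∧
        (∀ x y, 0 ≤ E x y) ∧ (∀ x y, 0 ≤ R' x y) ∧ (∀ x y, 0 ≤ Ea x y) ∧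
        (1 + diagonal (fun p => (w p : ℂ)) * klPairArrayF L M β U μ n Qm) * N₀ = 1 ∧
        (∀ k ∈ klBall L μ 0, ∀ k' ∈ klBall L μ 0,
          ‖klPairAmplitude L M β U μ (klFlowFrameU L M β U μ (n + 1)) (n + 1) Qm k k' - (klPairArrayF L M β U μ n Qm * N₀) k k'‖ ≤ E k k') ∧
        (∀ x y, E x y ≤ e) ∧
        (1 - diagonal (fun p => (b' p : ℂ)) * klPairArrayF L M β U μ n Qm) * M' = 1 ∧
        (∀ k ∈ klBall L μ 0, ∀ k' ∈ klBall L μ 0, ‖X k k' - (klPairArrayF L M β U μ n Qm * M') k k'‖ ≤ R' k k') ∧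
        (1 + diagonal (fun p => (w₁ p : ℂ)) * X) * N = 1 ∧
        (∀ k ∈ klBall L μ 0, ∀ k' ∈ klBall L μ 0, ‖Y k k' - (X * N) k k'‖ ≤ Ea k k') ∧
        (∀ x y, R' x y + (E x y + 3 / 2 * m * ∑ t, E x t * |w t + b' t| + 3 / 2 * (m + e) * ∑ a, |w a + b' a| * E a y +
            9 / 4 * (m + e) * m * ∑ a, ∑ t, |w a + b' a| * E a t * |w t + b' t|) ≤ E₁ x y) ∧
        (∀ x y, E₁ x y ≤ e₁) ∧
        (m + e) * ∑ a, |w a + b' a| ≤ 1 / 3 ∧ (3 / 2 * m + e₁) * ∑ a, |w₁ a| ≤ 1 / 3 ∧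
        (∑ p, |(b' p + w p - w₁ p) - klTransferWeight L M β μ (klFlowFrameU L M β U μ (n + 1)) (n + 1) φ Qm p| ≤ δ) ∧
        m * ∑ p, |b' p + w p - w₁ p| ≤ 1 / 3 ∧
        m * ∑ p, |klTransferWeight L M β μ (klFlowFrameU L M β U μ (n + 1)) (n + 1) φ Qm p| ≤ 1 / 3 ∧
        (∀ k ∈ klBall L μ 0, ∀ k' ∈ klBall L μ 0,
          Ea k k' + (E₁ k k' + 3 / 2 * (3 / 2 * m) * ∑ t, E₁ k t * |w₁ t| + 3 / 2 * (3 / 2 * m + e₁) * ∑ a, |w₁ a| * E₁ a k' +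
              9 / 4 * (3 / 2 * m + e₁) * (3 / 2 * m) * ∑ a, ∑ t, |w₁ a| * E₁ a t * |w₁ t|) + 9 / 4 * m ^ 2 * δ ≤
            transferBarAt L G P r β U (n + 1) Qm k k')) :
    PairTransferPinnedAt L M G P r β U μ (n + 1) φ := by
  intro Qm hQm
  obtain ⟨X, Y, N₀, M', N, w, b', w₁, E, R', Ea, E₁, e, e₁, δ, he, he₁, hX0, hY0, hYeq, hE0, hR'0, hEa0, hN₀, hE, hEe, hM', hR', hN, hEa,
    hE₁, hE₁e, hsm₁, hsm₂, hδ, hsb, hst, hbud⟩ := hdata Qm hQm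
  -- the plain-step error against `C₁` itself (on the ball `C₁ = klPairAmplitude`)
  have hE' : ∀ k ∈ klBall L μ 0, ∀ k' ∈ klBall L μ 0,
      ‖klPairArrayF L M β U μ (n + 1) Qm k k' - (klPairArrayF L M β U μ n Qm * N₀) k k'‖ ≤ E k k' := by
    intro k hk k' hk'
    rw [klPairArrayF_apply_of_mem L M β U μ (n + 1) Qm hk hk']
    exact hE k hk k' hk'
  obtain ⟨M₀, h1, -, hbd⟩ := kltc_transfer_compose_fwd_on_repin (klBall L μ 0) (klPairArrayF L M β U μ n Qm) (klPairArrayF L M β U μ (n + 1) Qm)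
    X Y N₀ M' N w b' w₁ (fun p => klTransferWeight L M β μ (klFlowFrameU L M β U μ (n + 1)) (n + 1) φ Qm p) E R' Ea E₁ hm he he₁ (hC₁ Qm)
    (klPairArrayF_eq_zero_off L M β U μ n Qm) (klPairArrayF_eq_zero_off L M β U μ (n + 1) Qm) hX0 hY0 hE0 hR'0 hEa0 hN₀ hE' hEe hM' hR' hN hEa
    hE₁ hE₁e hsm₁ hsm₂ hδ hsb hst
  refine ⟨M₀, h1, fun k hk k' hk' => ?_⟩
  rw [← hYeq k hk k' hk']
  exact (hbd k hk k' hk').trans (hbud k hk k' hk')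

end Door

/-! ## §2 The slack `δ` against the conservation identity -/

section Slack

variable {L M : ℕ} [NeZero L] (β μ : ℝ) (K : TrigPolyC4v)

omit [NeZero L] in
/-- **The composite weight minus the pinned target, against identity 1** (all weights at ONE frame `K`):
`(b′ + w − w₁) − t_{n+1}[φ] = (b′ − t_n[φ + s_{n+1}]) + (w − w^{plain}_{n+1}) − (w₁ − w₁^{(φ)}_{n+1})` pointwise (`klTransferWeight_succ`). -/
theorem composite_sub_klTransferWeight_succ_eq (n : ℕ) (φ : FreqMomentum L M → ℝ) (b' w w₁ : TorusSite 2 L → ℝ) (Qm p : TorusSite 2 L) :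
    (b' p + w p - w₁ p) - klTransferWeight L M β μ K (n + 1) φ Qm p =
      (b' p - klTransferWeight L M β μ K n (φ + softSymbolCompl L M β μ K n (n + 1)) Qm p) +
        (w p - klSliceWeightPlain L M β μ K (n + 1) Qm p) - (w₁ p - klSliceWeightSmeared L M β μ K (n + 1) φ Qm p) := by
  rw [klTransferWeight_succ]
  ring

/-- **The slack bound**: `Σ_p |(b′ + w − w₁) − t_{n+1}[φ]| ≤ Σ|b′ − t_n[φ + s_{n+1}]| + Σ|w − w^{plain}_{n+1}| + Σ|w₁ − w₁^{(φ)}_{n+1}|` — frame slack of the pinned history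
weight plus the deviations of the tower's actual rung weights from the model slice weights. -/
theorem sum_abs_composite_sub_klTransferWeight_succ_le (n : ℕ) (φ : FreqMomentum L M → ℝ) (b' w w₁ : TorusSite 2 L → ℝ) (Qm : TorusSite 2 L) :
    ∑ p, |(b' p + w p - w₁ p) - klTransferWeight L M β μ K (n + 1) φ Qm p| ≤
      ∑ p, |b' p - klTransferWeight L M β μ K n (φ + softSymbolCompl L M β μ K n (n + 1)) Qm p| +
        ∑ p, |w p - klSliceWeightPlain L M β μ K (n + 1) Qm p| + ∑ p, |w₁ p - klSliceWeightSmeared L M β μ K (n + 1) φ Qm p| := by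
  rw [← sum_add_distrib, ← sum_add_distrib]
  refine sum_le_sum fun p _ => ?_
  rw [composite_sub_klTransferWeight_succ_eq]
  exact (abs_sub _ _).trans (add_le_add (abs_add_le _ _) le_rfl)

omit [NeZero L] in
/-- **At a fixed frame with the model weights the slack vanishes**: `b′ := t_n[φ + s_{n+1}]`, `w := w^{plain}_{n+1}`, `w₁ := w₁^{(φ)}_{n+1}` ⇒ `b′ + w − w₁ = t_{n+1}[φ]`. -/
theorem composite_eq_klTransferWeight_succ (n : ℕ) (φ : FreqMomentum L M → ℝ) (Qm p : TorusSite 2 L) :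
    klTransferWeight L M β μ K n (φ + softSymbolCompl L M β μ K n (n + 1)) Qm p + klSliceWeightPlain L M β μ K (n + 1) Qm p -
        klSliceWeightSmeared L M β μ K (n + 1) φ Qm p =
      klTransferWeight L M β μ K (n + 1) φ Qm p := by
  rw [klTransferWeight_succ]

/-- … so `δ = 0` is admissible there: `Σ_p |(t_n[φ+s] + w^{plain} − w₁^{(φ)}) − t_{n+1}[φ]| ≤ 0`. -/
theorem sum_abs_modelComposite_sub_klTransferWeight_succ_le_zero (n : ℕ) (φ : FreqMomentum L M → ℝ) (Qm : TorusSite 2 L) :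
    ∑ p, |(klTransferWeight L M β μ K n (φ + softSymbolCompl L M β μ K n (n + 1)) Qm p + klSliceWeightPlain L M β μ K (n + 1) Qm p -
        klSliceWeightSmeared L M β μ K (n + 1) φ Qm p) - klTransferWeight L M β μ K (n + 1) φ Qm p| ≤ 0 := by
  refine le_of_eq (sum_eq_zero fun p _ => ?_)
  rw [composite_eq_klTransferWeight_succ, sub_self, abs_zero]

end Slack

/-! ## §3 The pinned re-key of the (E2-F2) member door (p546910) -/

section Rekey

variable (L M : ℕ) [NeZero L] [NeZero M]

/-- **(E2-F2) `PairLadderStepAtV17F2 … n` (`1 ≤ n`) from the PINNED class-#5 history member `PairTransferPinnedAt … (n−1) φ` and its tower along slice `n`, BY NAME** —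
p546910 fed through `pairTransferAtCov_of_pinned_of_frameOK` (the mass/sign lines of the pinned weight discharged under `FrameOK R U N μ (K_{n−1})`, `klBetaMin ≤ β ≤ L`,
`2^18 ≤ G.bhi`); the caller's per-class tower data are p546910's with `D := softCovOf … (K_{n−1}) φ`. -/
theorem pairLadderStepAtV17F2_of_pairTransferPinnedAt {G : GeoConsts} {P : SplitConsts} {Q : EngConsts} {R : RenConsts} {N : ℕ} {r β U μ : ℝ} {n : ℕ} {m : ℝ}
    {φ : FreqMomentum L M → ℝ} (hn : 1 ≤ n) (hm : 0 ≤ m)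
    (hK : FrameOK R U N μ (klFlowFrameU L M β U μ (n - 1))) (hβ : klBetaMin ≤ β) (hβL : β ≤ L) (hG : (2 : ℝ) ^ 18 ≤ G.bhi)
    (hφ : IsSoftSymbol L M β μ (klFlowFrameU L M β U μ (n - 1)) (n - 1) φ) (hpin : PairTransferPinnedAt L M G P r β U μ (n - 1) φ)
    (hC₀ : ∀ Qm s t, ‖klPairArrayF L M β U μ (n - 1) Qm s t‖ ≤ m)
    (hR'0 : ∀ Qm k k', 0 ≤ transferBarAt L G P r β U (n - 1) Qm k k')
    (hsm₀ : m * (G.bhi / 4) ≤ 1 / 3)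
    (htower : ∀ Qm : TorusSite 2 L, IsPairClassAt L Qm n →
      ∃ (X N : Matrix (TorusSite 2 L) (TorusSite 2 L) ℂ) (w₁ : TorusSite 2 L → ℝ) (Ea E₁ : TorusSite 2 L → TorusSite 2 L → ℝ) (r' e₁ : ℝ),
        0 ≤ r' ∧ 0 ≤ e₁ ∧
        (∀ x y, ¬(x ∈ klBall L μ 0 ∧ y ∈ klBall L μ 0) → X x y = 0) ∧
        (∀ k ∈ klBall L μ 0, ∀ k' ∈ klBall L μ 0,
          X k k' = klCovSmearedPairAmplitude L M β U μ (klFlowFrameU L M β U μ (n - 1)) (n - 1)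
            (softCovOf L M β μ (klFlowFrameU L M β U μ (n - 1)) φ) Qm k k') ∧
        (∀ x y, 0 ≤ Ea x y) ∧
        (1 + diagonal (fun p => (w₁ p : ℂ)) * X) * N = 1 ∧
        (∀ k ∈ klBall L μ 0, ∀ k' ∈ klBall L μ 0, ‖klPairArrayF L M β U μ n Qm k k' - (X * N) k k'‖ ≤ Ea k k') ∧
        (∀ x y, transferBarAt L G P r β U (n - 1) Qm x y ≤ r') ∧
        (∀ x y, Ea x y + (transferBarAt L G P r β U (n - 1) Qm x y +
            3 / 2 * (3 / 2 * m) * ∑ t, transferBarAt L G P r β U (n - 1) Qm x t * |w₁ t| +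
            3 / 2 * (3 / 2 * m + r') * ∑ a, |w₁ a| * transferBarAt L G P r β U (n - 1) Qm a y +
            9 / 4 * (3 / 2 * m + r') * (3 / 2 * m) * ∑ a, ∑ t, |w₁ a| * transferBarAt L G P r β U (n - 1) Qm a t * |w₁ t|) ≤ E₁ x y) ∧
        (∀ x y, E₁ x y ≤ e₁) ∧
        (3 / 2 * m + r') * ∑ a, |w₁ a| ≤ 1 / 3 ∧
        (∑ p, |w₁ p| ≤ 3 / 4 * G.bhi) ∧
        (∑ p, (|w₁ p| - w₁ p) ≤ klEdge G n (klTorusNorm L Qm)) ∧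
        (∀ k ∈ klBall L μ 0, ∀ k' ∈ klBall L μ 0,
          E₁ k k' ≤
            drivePBar G P U (n - 1) + eremBar G P Q U β L (n - 1) + thermalBar G P U β n +
              legDressBarQ2 G P Q U n (legSliceCountT L β μ (klFlowFrameU L M β U μ n) n ![k', Qm - k', Qm - k, k]) +
              (P.Klam * U) ^ 2 * (G.phGain n (klTorusNorm L (k - k')) + G.phGain n (klTorusNorm L (k + k' - Qm))) +
              frameShiftBar P Q U n)) :
    PairLadderStepAtV17F2 L M G P Q β U μ n :=
  pairLadderStepAtV17F2_of_pairTransferAtCov L M hn (le_trans (by positivity) hG) hm hC₀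
    (pairTransferAtCov_of_pinned_of_frameOK hK hβ hβL hG hφ hpin) hR'0 hsm₀ htower

end Rekey

end Summit.HubbardSuperconductivity.HubbardSuperconductivity.Theorems.KLRegimeSplit

end
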